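import Mathlib
import Literature.MathematicalPhysics.QuantumManyBody.SwapPurity
import Literature.MathematicalPhysics.QuantumManyBody.PeriodicBoseGas
import HarnessLib

/-!
# Route BECSwapNoCatastrophe — two-copy swap calculus for `MidpointLemma`
(item stmt-AtomisticToContinuum-14396): glue coordinates, the swap identity, the midpoint inequality

Support file (does not close the item) for the proof of
`Summit.AtomisticToContinuum.BoseEinsteinCondensation.Theses.BECSwapNoCatastrophe.MidpointLemma`
(`TorusHalfSwapOverlap → TorusSwapBound`) in `BECSwapNoCatastropheMidpointLemma.lean`.

Two copies of `N = n + 1` particles in `ℝ³` have configuration space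
`(ℝ³)^{n+1} × (ℝ³)^{n+1} ∋ (X, Y)`; the one-pair swap is `F : (X, Y) ↦ (y₀ :: X̂, x₀ :: Ŷ)`
(`X = x₀ :: X̂`, `Y = y₀ :: Ŷ`, `x :: X̂ = Matrix.vecCons x X̂`). Everything is done in the
**glue coordinates** `q = ((X̂, Ŷ), (x, y)) ∈ ((ℝ³)ⁿ × (ℝ³)ⁿ) × (ℝ³ × ℝ³)`, glued to `(X, Y)` by
`e q = (x :: X̂, y :: Ŷ)`, in which the swap is the measure-preserving involution
`Prod.map id Prod.swap`:

* `exists_measurableEquiv_twoCopy` — `e` is a measure-preserving measurable equivalence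
  (Lebesgue measures), assembled from Mathlib's `prodComm`/`prodAssoc`/`piFinSuccAbove`.
* `lintegral_twoCopy_prod` — `‖Ψ ⊗ Ψ‖₂² = ‖Ψ‖₂⁴` in glue coordinates (Tonelli).
* `integral_twoCopy_swap_eq_swapPurity` — the **swap identity**
  `⟨(Ψ⊗Ψ)∘F, Ψ⊗Ψ⟩ = ∫∫ |∫ Ψ(x::X̂) conj Ψ(x::Ŷ) dx|² dX̂ dŶ = swapPurity n Ψ` (Fubini): the
  two-replica expectation of the one-particle swap is Penrose–Onsager's `A₂ = tr(γ_Ψ²)/N²`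
  [PenroseOnsager1956 §4 (6); HerdmanEtAl2014 §II].
* `two_mul_norm_inner_sq_sub_le_re_inner` — the **midpoint inequality** in a complex Hilbert
  space: for a unit vector `θ` and `φ, ψ` with `‖ψ‖ = ‖φ‖`, `⟨θ, ψ⟩ = ⟨θ, φ⟩`:
  `2|⟨θ, φ⟩|² - ‖φ‖² ≤ Re ⟨ψ, φ⟩` (Cauchy–Schwarz against `φ + ψ`; with `ψ = Uφ` for a unitary
  involution `U` fixing `θ` this is `⟨φ, Uφ⟩ = 2‖Pφ‖² - 1 ≥ 2|⟨θ, φ⟩|² - 1`, `P = (1+U)/2`);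
  `eLpNorm_two_eq_one_of_lintegral` — `‖f‖_{L²} = 1` from `∫ |f|² = 1`;
  `exists_le_iInf₂_add` — near-minimisers of an `ℝ≥0∞`-valued functional over a non-empty class.
-/

noncomputable section

-- The Lebesgue `MeasureSpace` instance of the glue coordinates
-- `((ℝ³)ⁿ × (ℝ³)ⁿ) × (ℝ³ × ℝ³)` is found by the default search but its term exceeds the default
-- `synthInstance.maxSize` (four copies of the `EuclideanSpace` instance); raise the bound.
set_option synthInstance.maxSize 512

open MeasureTheory
open scoped ENNReal NNReal ComplexConjugate InnerProductSpace

namespace Summit.AtomisticToContinuum.BoseEinsteinCondensation.Theorems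

open Literature.MathematicalPhysics.QuantumManyBody.BoseGas

variable {n : ℕ}

/-! ### Coordinates -/

/-- **Glue coordinates.** There is a measure-preserving measurable equivalence
`((X̂, Ŷ), (x, y)) ↦ (x :: X̂, y :: Ŷ)` between `((ℝ³)ⁿ × (ℝ³)ⁿ) × (ℝ³ × ℝ³)` and the two-copy
configuration space `(ℝ³)^{n+1} × (ℝ³)^{n+1}` (Lebesgue measures). [folklore] -/
theorem exists_measurableEquiv_twoCopy (n : ℕ) :
    ∃ e : (Config n × Config n) × (Space × Space) ≃ᵐ Config (n + 1) × Config (n + 1),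
      MeasurePreserving e volume volume ∧
        ∀ q, e q = (Matrix.vecCons q.2.1 q.1.1, Matrix.vecCons q.2.2 q.1.2) := by
  -- `x :: X̂` as a measurable equivalence `ℝ³ × (ℝ³)ⁿ ≃ (ℝ³)^{n+1}`
  let eC : Space × Config n ≃ᵐ Config (n + 1) :=
    (MeasurableEquiv.piFinSuccAbove (fun _ : Fin (n + 1) => Space) 0).symm
  have heC : MeasurePreserving eC ((volume : Measure Space).prod (volume : Measure (Config n)))
      volume :=
    (volume_preserving_piFinSuccAbove (fun _ : Fin (n + 1) => Space) 0).symm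
  -- the coordinate shuffle `((X̂, Ŷ), (x, y)) ↦ ((x, X̂), (y, Ŷ))` in six elementary moves
  let s1 : (Config n × Config n) × (Space × Space) ≃ᵐ (Space × Space) × (Config n × Config n) :=
    MeasurableEquiv.prodComm
  let s2 : (Space × Space) × (Config n × Config n) ≃ᵐ Space × (Space × (Config n × Config n)) :=
    MeasurableEquiv.prodAssoc
  let s3 : Space × (Space × (Config n × Config n)) ≃ᵐ Space × ((Space × Config n) × Config n) :=
    MeasurableEquiv.prodCongr (MeasurableEquiv.refl Space) MeasurableEquiv.prodAssoc.symm
  let s4 : Space × ((Space × Config n) × Config n) ≃ᵐ Space × ((Config n × Space) × Config n) :=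
    MeasurableEquiv.prodCongr (MeasurableEquiv.refl Space)
      (MeasurableEquiv.prodCongr MeasurableEquiv.prodComm (MeasurableEquiv.refl (Config n)))
  let s5 : Space × ((Config n × Space) × Config n) ≃ᵐ Space × (Config n × (Space × Config n)) :=
    MeasurableEquiv.prodCongr (MeasurableEquiv.refl Space) MeasurableEquiv.prodAssoc
  let s6 : Space × (Config n × (Space × Config n)) ≃ᵐ (Space × Config n) × (Space × Config n) :=
    MeasurableEquiv.prodAssoc.symm
  let s7 : (Space × Config n) × (Space × Config n) ≃ᵐ Config (n + 1) × Config (n + 1) :=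
    MeasurableEquiv.prodCongr eC eC
  refine ⟨(((((s1.trans s2).trans s3).trans s4).trans s5).trans s6).trans s7, ?_, ?_⟩
  · have h1 : MeasurePreserving s1
        (((volume : Measure (Config n)).prod (volume : Measure (Config n))).prod
          ((volume : Measure Space).prod (volume : Measure Space)))
        (((volume : Measure Space).prod (volume : Measure Space)).prod
          ((volume : Measure (Config n)).prod (volume : Measure (Config n)))) :=
      Measure.measurePreserving_swap
    have h2 : MeasurePreserving s2
        (((volume : Measure Space).prod (volume : Measure Space)).prod
          ((volume : Measure (Config n)).prod (volume : Measure (Config n))))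
        ((volume : Measure Space).prod ((volume : Measure Space).prod
          ((volume : Measure (Config n)).prod (volume : Measure (Config n))))) :=
      measurePreserving_prodAssoc _ _ _
    have h3 : MeasurePreserving s3
        ((volume : Measure Space).prod ((volume : Measure Space).prod
          ((volume : Measure (Config n)).prod (volume : Measure (Config n)))))
        ((volume : Measure Space).prod (((volume : Measure Space).prod
          (volume : Measure (Config n))).prod (volume : Measure (Config n)))) :=
      (MeasurePreserving.id _).prod
        (measurePreserving_prodAssoc (volume : Measure Space) (volume : Measure (Config n))
          (volume : Measure (Config n))).symm
    have h4 : MeasurePreserving s4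
        ((volume : Measure Space).prod (((volume : Measure Space).prod
          (volume : Measure (Config n))).prod (volume : Measure (Config n))))
        ((volume : Measure Space).prod (((volume : Measure (Config n)).prod
          (volume : Measure Space)).prod (volume : Measure (Config n)))) :=
      (MeasurePreserving.id _).prod
        (Measure.measurePreserving_swap.prod (MeasurePreserving.id _))
    have h5 : MeasurePreserving s5
        ((volume : Measure Space).prod (((volume : Measure (Config n)).prod
          (volume : Measure Space)).prod (volume : Measure (Config n))))
        ((volume : Measure Space).prod ((volume : Measure (Config n)).prod
          ((volume : Measure Space).prod (volume : Measure (Config n))))) :=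
      (MeasurePreserving.id _).prod (measurePreserving_prodAssoc _ _ _)
    have h6 : MeasurePreserving s6
        ((volume : Measure Space).prod ((volume : Measure (Config n)).prod
          ((volume : Measure Space).prod (volume : Measure (Config n)))))
        (((volume : Measure Space).prod (volume : Measure (Config n))).prod
          ((volume : Measure Space).prod (volume : Measure (Config n)))) :=
      (measurePreserving_prodAssoc (volume : Measure Space) (volume : Measure (Config n))
        ((volume : Measure Space).prod (volume : Measure (Config n)))).symm
    have h7 : MeasurePreserving s7
        (((volume : Measure Space).prod (volume : Measure (Config n))).prod
          ((volume : Measure Space).prod (volume : Measure (Config n))))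
        ((volume : Measure (Config (n + 1))).prod (volume : Measure (Config (n + 1)))) :=
      heC.prod heC
    exact (((((h1.trans h2).trans h3).trans h4).trans h5).trans h6).trans h7
  · intro q
    change (eC (q.2.1, q.1.1), eC (q.2.2, q.1.2)) = _
    rw [piFinSuccAbove_symm_apply_eq_vecCons, piFinSuccAbove_symm_apply_eq_vecCons]

/-- Measurability of `q ↦ x :: X̂` and `q ↦ y :: Ŷ` in glue coordinates. [folklore] -/
theorem twoCopy_measurable_vecCons :
    (Measurable fun q : (Config n × Config n) × (Space × Space) =>
        Matrix.vecCons q.2.1 q.1.1) ∧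
      Measurable fun q : (Config n × Config n) × (Space × Space) =>
        Matrix.vecCons q.2.2 q.1.2 :=
  ⟨measurable_vecCons.comp (measurable_snd.fst.prodMk measurable_fst.fst),
    measurable_vecCons.comp (measurable_snd.snd.prodMk measurable_fst.snd)⟩

/-! ### The product state and the swap identity -/

/-- **`‖Ψ ⊗ Ψ‖₂² = ‖Ψ‖₂⁴`** in glue coordinates:
`∫ |Ψ(x :: X̂)|² |Ψ(y :: Ŷ)|² d((X̂, Ŷ), (x, y)) = (∫ |Ψ|²)²` (glue + Tonelli). [folklore] -/
theorem lintegral_twoCopy_prod {Ψ : Config (n + 1) → ℂ} (hΨ : Measurable Ψ) :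
    ∫⁻ q : (Config n × Config n) × (Space × Space),
        (‖Ψ (Matrix.vecCons q.2.1 q.1.1) * Ψ (Matrix.vecCons q.2.2 q.1.2)‖₊ : ℝ≥0∞) ^ 2 =
      (∫⁻ Z, (‖Ψ Z‖₊ : ℝ≥0∞) ^ 2) ^ 2 := by
  obtain ⟨e, he, hecoe⟩ := exists_measurableEquiv_twoCopy n
  have h2 : Measurable fun Z : Config (n + 1) => (‖Ψ Z‖₊ : ℝ≥0∞) ^ 2 :=
    hΨ.nnnorm.coe_nnreal_ennreal.pow_const 2
  have hG : Measurable fun Z : Config (n + 1) × Config (n + 1) =>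
      (‖Ψ Z.1 * Ψ Z.2‖₊ : ℝ≥0∞) ^ 2 :=
    ((hΨ.comp measurable_fst).mul (hΨ.comp measurable_snd)).nnnorm.coe_nnreal_ennreal.pow_const 2
  calc ∫⁻ q : (Config n × Config n) × (Space × Space),
        (‖Ψ (Matrix.vecCons q.2.1 q.1.1) * Ψ (Matrix.vecCons q.2.2 q.1.2)‖₊ : ℝ≥0∞) ^ 2
      = ∫⁻ q, (fun Z : Config (n + 1) × Config (n + 1) =>
          (‖Ψ Z.1 * Ψ Z.2‖₊ : ℝ≥0∞) ^ 2) (e q) := by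
        refine lintegral_congr fun q => ?_
        rw [hecoe]
    _ = ∫⁻ Z : Config (n + 1) × Config (n + 1), (‖Ψ Z.1 * Ψ Z.2‖₊ : ℝ≥0∞) ^ 2 :=
        he.lintegral_comp hG
    _ = ∫⁻ Z : Config (n + 1) × Config (n + 1),
          (‖Ψ Z.1‖₊ : ℝ≥0∞) ^ 2 * (‖Ψ Z.2‖₊ : ℝ≥0∞) ^ 2 := by
        refine lintegral_congr fun Z => ?_
        rw [nnnorm_mul, ENNReal.coe_mul, mul_pow]
    _ = (∫⁻ X, (‖Ψ X‖₊ : ℝ≥0∞) ^ 2) * ∫⁻ Y, (‖Ψ Y‖₊ : ℝ≥0∞) ^ 2 := by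
        rw [Measure.volume_eq_prod]
        exact lintegral_prod_mul h2.aemeasurable h2.aemeasurable
    _ = (∫⁻ Z, (‖Ψ Z‖₊ : ℝ≥0∞) ^ 2) ^ 2 := by rw [sq]

/-- **Swap identity.** For measurable `Ψ : (ℝ³)^{n+1} → ℂ` (with the integrand integrable),
`∫ conj(Ψ(y::X̂) Ψ(x::Ŷ)) · Ψ(x::X̂) Ψ(y::Ŷ) d((X̂,Ŷ),(x,y)) = swapPurity n Ψ`: integrating
`(x, y)` first gives `K(X̂,Ŷ) conj K(X̂,Ŷ) = |K(X̂,Ŷ)|²` with the swap kernel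
`K(X̂,Ŷ) = ∫ Ψ(x::X̂) conj Ψ(x::Ŷ) dx`, i.e. the two-replica expectation of the one-particle
swap `⟨(Ψ⊗Ψ)∘F, Ψ⊗Ψ⟩` is Penrose–Onsager's `A₂ = tr(γ_Ψ²)/N²`.
[cite: HerdmanEtAl2014, §II (⟨Ψ,Ψ̃|Π₂^A|Ψ,Ψ̃⟩ = e^{-S₂} = tr ρ_A², n = 1)] -/
theorem integral_twoCopy_swap_eq_swapPurity {Ψ : Config (n + 1) → ℂ} (hΨ : Measurable Ψ)
    (hint : Integrable (fun q : (Config n × Config n) × (Space × Space) =>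
      conj (Ψ (Matrix.vecCons q.2.2 q.1.1) * Ψ (Matrix.vecCons q.2.1 q.1.2)) *
        (Ψ (Matrix.vecCons q.2.1 q.1.1) * Ψ (Matrix.vecCons q.2.2 q.1.2))) volume) :
    ∫ q : (Config n × Config n) × (Space × Space),
        conj (Ψ (Matrix.vecCons q.2.2 q.1.1) * Ψ (Matrix.vecCons q.2.1 q.1.2)) *
          (Ψ (Matrix.vecCons q.2.1 q.1.1) * Ψ (Matrix.vecCons q.2.2 q.1.2)) =
      ((swapPurity n Ψ).toReal : ℂ) := by
  -- the swap kernel `K(X̂, Ŷ) = ∫ Ψ(x::X̂) conj Ψ(x::Ŷ) dx`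
  set K : Config n × Config n → ℂ := fun P =>
    ∫ x, Ψ (Matrix.vecCons x P.1) * conj (Ψ (Matrix.vecCons x P.2)) with hK
  have hKm : Measurable K := measurable_swapKernel hΨ
  -- the inner `(x, y)`-integral is `K conj K = |K|²`
  have hinner : ∀ P : Config n × Config n,
      ∫ p : Space × Space, conj (Ψ (Matrix.vecCons p.2 P.1) * Ψ (Matrix.vecCons p.1 P.2)) *
          (Ψ (Matrix.vecCons p.1 P.1) * Ψ (Matrix.vecCons p.2 P.2)) =
        ((‖K P‖ ^ 2 : ℝ) : ℂ) := by
    intro P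
    have hsplit : (fun p : Space × Space =>
        conj (Ψ (Matrix.vecCons p.2 P.1) * Ψ (Matrix.vecCons p.1 P.2)) *
          (Ψ (Matrix.vecCons p.1 P.1) * Ψ (Matrix.vecCons p.2 P.2))) =
        fun p : Space × Space => (Ψ (Matrix.vecCons p.1 P.1) * conj (Ψ (Matrix.vecCons p.1 P.2))) *
          (conj (Ψ (Matrix.vecCons p.2 P.1)) * Ψ (Matrix.vecCons p.2 P.2)) := by
      funext p
      rw [map_mul]
      ring
    have hconj : ∫ y : Space, conj (Ψ (Matrix.vecCons y P.1)) * Ψ (Matrix.vecCons y P.2) =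
        conj (K P) := by
      rw [hK, ← integral_conj]
      refine integral_congr_ae (Filter.Eventually.of_forall fun y => ?_)
      simp only [map_mul, RCLike.conj_conj]
    rw [hsplit, Measure.volume_eq_prod,
      integral_prod_mul (μ := (volume : Measure Space)) (ν := (volume : Measure Space))
        (fun x => Ψ (Matrix.vecCons x P.1) * conj (Ψ (Matrix.vecCons x P.2)))
        (fun y => conj (Ψ (Matrix.vecCons y P.1)) * Ψ (Matrix.vecCons y P.2)),
      hconj, RCLike.mul_conj]
    push_cast
    rfl
  rw [Measure.volume_eq_prod, integral_prod _ hint]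
  simp only [hinner]
  rw [integral_complex_ofReal]
  congr 1
  rw [integral_eq_lintegral_of_nonneg_ae (Filter.Eventually.of_forall fun P => sq_nonneg _)
      (hKm.norm.pow_const 2).aestronglyMeasurable]
  congr 1
  rw [swapPurity]
  refine lintegral_congr fun P => ?_
  rw [ENNReal.ofReal_pow (norm_nonneg _), ofReal_norm]
  rfl

/-! ### Three generic lemmas -/

/-- **Midpoint inequality in a complex Hilbert space.** If `‖θ‖ = 1`, `‖ψ‖ = ‖φ‖` and
`⟨θ, ψ⟩ = ⟨θ, φ⟩`, then `2 |⟨θ, φ⟩|² - ‖φ‖² ≤ Re ⟨ψ, φ⟩`: by Cauchy–Schwarz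
`4|⟨θ, φ⟩|² = |⟨θ, φ + ψ⟩|² ≤ ‖φ + ψ‖² = 2‖φ‖² + 2 Re⟨ψ, φ⟩`. With `ψ = Uφ` for a unitary
involution `U` fixing `θ` this is the bound `⟨φ, Uφ⟩ = 2‖Pφ‖² - 1 ≥ 2|⟨θ, φ⟩|² - 1`
(`P = (1 + U)/2`, `θ = Pθ`, unit `φ`). [folklore] -/
theorem two_mul_norm_inner_sq_sub_le_re_inner {E : Type*} [NormedAddCommGroup E]
    [InnerProductSpace ℂ E] (θ φ ψ : E) (hθ : ‖θ‖ = 1) (hψ : ‖ψ‖ = ‖φ‖)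
    (h : ⟪θ, ψ⟫_ℂ = ⟪θ, φ⟫_ℂ) :
    2 * ‖⟪θ, φ⟫_ℂ‖ ^ 2 - ‖φ‖ ^ 2 ≤ RCLike.re ⟪ψ, φ⟫_ℂ := by
  have h1 : ‖⟪θ, φ + ψ⟫_ℂ‖ ≤ ‖φ + ψ‖ := by
    have := norm_inner_le_norm (𝕜 := ℂ) θ (φ + ψ)
    rwa [hθ, one_mul] at this
  have h2 : ⟪θ, φ + ψ⟫_ℂ = 2 * ⟪θ, φ⟫_ℂ := by
    rw [inner_add_right, h]
    ring
  have h3 : ‖φ + ψ‖ ^ 2 = ‖φ‖ ^ 2 + 2 * RCLike.re ⟪φ, ψ⟫_ℂ + ‖ψ‖ ^ 2 :=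
    norm_add_sq (𝕜 := ℂ) φ ψ
  have h4 : RCLike.re ⟪φ, ψ⟫_ℂ = RCLike.re ⟪ψ, φ⟫_ℂ := by
    rw [← inner_conj_symm, RCLike.conj_re]
  have h5 : ‖⟪θ, φ + ψ⟫_ℂ‖ ^ 2 ≤ ‖φ + ψ‖ ^ 2 := by
    gcongr
  rw [h2, norm_mul, RCLike.norm_two, h3, h4, hψ] at h5
  nlinarith [h5]

/-- `‖f‖_{L²} = 1` if `∫ |f|² = 1`. [folklore] -/
theorem eLpNorm_two_eq_one_of_lintegral {α : Type*} [MeasurableSpace α] {μ : Measure α}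
    {f : α → ℂ} (h : ∫⁻ x, (‖f x‖₊ : ℝ≥0∞) ^ 2 ∂μ = 1) : eLpNorm f 2 μ = 1 := by
  rw [eLpNorm_eq_lintegral_rpow_enorm_toReal two_ne_zero ENNReal.ofNat_ne_top,
    ENNReal.toReal_ofNat]
  have h' : ∫⁻ x, ‖f x‖ₑ ^ (2 : ℝ) ∂μ = 1 := by
    rw [← h]
    refine lintegral_congr fun x => ?_
    rw [ENNReal.rpow_two]
    rfl
  rw [h', ENNReal.one_rpow]

/-- **Near-minimisers exist.** For `E : ι → [0, ∞]` and a non-empty class `P`, every slack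
`δ > 0` admits `i ∈ P` with `E i ≤ inf_P E + δ` (if `inf_P E = ⊤` any member of `P` works,
otherwise `inf < inf + δ`). [folklore] -/
theorem exists_le_iInf₂_add {ι : Sort*} {P : ι → Prop} (E : ι → ℝ≥0∞) (h0 : ∃ i, P i)
    {δ : ℝ≥0∞} (hδ : 0 < δ) : ∃ i, P i ∧ E i ≤ (⨅ (j : ι) (_ : P j), E j) + δ := by
  by_contra hcon
  push Not at hcon
  have hle : (⨅ (j : ι) (_ : P j), E j) + δ ≤ ⨅ (j : ι) (_ : P j), E j :=
    le_iInf₂ fun j hj => (hcon j hj).le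
  obtain ⟨i, hi⟩ := h0
  rcases eq_or_ne (⨅ (j : ι) (_ : P j), E j) ⊤ with htop | htop
  · have h := hcon i hi
    rw [htop, top_add] at h
    exact not_top_lt h
  · exact absurd hle (not_le.2 (ENNReal.lt_add_right htop hδ.ne'))

end Summit.AtomisticToContinuum.BoseEinsteinCondensation.Theorems

end
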